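/-
Copyright (c) 2026 the pub-hodgecm-mathlib formalisation cell (harness21).  Prover seat hodgecm-mathlib-LH7-p10 (g3), req620 Track A «(D-RAM) FOUR-FRAME» squad
((β₂) road (R-36) «PURE-CELL LEDGER», β₂ WORD #28 (b) (K6-ii) «the OFF→GEN junction for a general cone cell» — its EXISTENCE half, conductor-free; asked by LH4-p19 (g3)
`RAYBANDS.sig.v1` da020308 §2 (e) ∕ ask (2) for the RAY bands at `d ≤ b`), helper lane on h413 = stmt-HodgeConjecture-24833 (count-neutral).  2026-09-05.
-/
import Summits.HodgeConjecture.HodgeConjecture.Theorems.F0P3cDyRamConeCellFaceTube               -- ★ (LH4-p16 (g0)): the frame; brings ★ `exists_coneData_of_gen`, ★ `map_glueNorm_eq`, ★ DEFS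
import Literature.NumberTheory.Automorphic.UnitaryLatticeTreeBlockGlueFibreCountPlane              -- ★ Lit: `ncard_glueFibre_map_planeMatrix_eq_natCard_normFibre`, `dualLatt_sup_span_eq_iff_forall_mem_iff`
import HarnessLib

/-!
# Crux `H413`, line LH4 «(D-RAM) FOUR-FRAME» — the (β₂) road (R-36), (K6-ii) OFF→GEN junction, EXISTENCE HALF: «A POPULATED CONE-CELL MEMBER CARRIES A GLUED SELF-DUAL
# VERTEX» — for `Λ ∈ levelSetDep(j, b; lam − jE u)` with `1 ≤ b` and glue weight `f b j Λ ≠ 0` there are `B` with `φ(B) = Λ` and a self-dual `L₃` with `L₃ ∩ W = ι_W B` and tube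
# coordinate `b` — at EVERY `b` (no `b + 1 ≤ d`, no parity), the conductor-free twin of ★ p863858 `…TubeCellGluedVertexExists.exists_glued_of_mem_levelSetDep_of_succ_le`

Cell `hodgecm-mathlib` (D-0151), FLOOR 0, crux item H413 = `stmt-HodgeConjecture-24833`, route of record `HCCMUnconditional`; squads F0∕P3c∕LH4 ∕ LH7; lane
`--supports stmt-HodgeConjecture-24833 --as helper` (count-neutral; pays NO tier-0 row).  THEOREMS ONLY (no `def`, no instance, no notation, no `sorry`, default heartbeats);
★-only imports; states NO law; (β₂) stays a HYPOTHESIS.  Frame = ★ `…ConeCellFaceTube.exists_fixed_unit_weight_eq_natCard_normFibre` (block `(H₂, h_W)` with `H₂` hermitian of unit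
determinant, `|h_W| = 1`, `σh_W = h_W`; ★ (C1)'s line model; ★ (C1)'s weight letter `hf` VERBATIM) plus the cell datum `1 ≤ b`, `lam ∈ 𝒪_j` — NO wild-datum exponent, NO `|2| < 1`.

WHY (LH4-p19 (g3) RAYBANDS.sig.v1 §2 (e), OPEN-2; β₂ WORD #28 (b) (K6-ii)).  The (OFF) literals of every lane quantify over GLUED self-dual `L₃ ⊃ ι_W B` with `φ(B) = Λ`; the count
sockets (★ p863807 ∕ p863833, LH4-p19's R0 `…_reads₄`) read `Λ ∈ levelSet(j, b)` under the guard `f b j Λ ≠ 0`.  Below the glue conductor (`b + 1 ≤ d`) ★ p863858 gives the glued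
vertex outright (★ T1: `#Sol_{2b}(r) = q^b ≠ 0`); at and above it (`d ≤ b`) existence is NOT unconditional — the glue fibre over the member's canonical plane datum `(B, b)` has
`#Sol_{2b}(r₀)` elements (★ Lit `ncard_glueFibre_map_planeMatrix_eq_natCard_normFibre`), `r₀ = −⟨w₀, w₀⟩·ϖ^bσ(ϖ^b)∕h_W` with `jE r₀ = glueUnit(x₀, b)` (★ `map_glueNorm_eq`), and
that is `2q^b` or `0` according as `r₀` is a norm (★ `…ConeCellFaceTubeAbove.weight_eq_two_mul_pow_or_eq_zero_of_le`).  But by ★ (C1)'s weight letter `hf` the SAME count is the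
glue weight `f b j Λ`; so `f b j Λ ≠ 0` makes the fibre non-empty — at every `b ≥ 1`, for every parity of `d`, with no wild-datum letter at all.
* HEAD `exists_glued_of_mem_levelSetDep_of_weight_ne_zero` — `Λ ∈ levelSetDep(j, b; lam − jE u) → f b j Λ ≠ 0 → ∃ B, φ(B) = Λ ∧ ∃ L₃, IsSelfDualLattice σ ϖ (block H₂ h_W) L₃ ∧
  L₃ ⊓ ker pr₁ = B.map ι ∧ (∀ c, c·e₁ ∈ L₃ ↔ |c| ≤ |ϖ|^b)` — the three conjuncts of the (OFF) literals' inner set, BYTE-SHAPED as in ★ p863858 ∕ ★ p863399 ∕ LH4-p12's ED. 6.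
* RIDER `exists_ncard_glued_eq_weight` — the same frame WITHOUT the guard, conclusion «over the canonical `B` the glued `L₃` are COUNTED BY THE WEIGHT»: `∃ B, φ(B) = Λ ∧
  #{L₃ ∣ …} = f b j Λ` (the fibre count IS the weight), from which the HEAD follows and which the per-capita readings (WORD #28 (b) (K6-iii) `n(j,b) = #fibre · #digits`) consume.
* COROLLARY `weight_eq_zero_of_forall_not_glued` — the contrapositive: no glued `L₃` over any `B` with `φ(B) = Λ` ⇒ `f b j Λ = 0`.
HONEST LABEL.  Count-neutral lattice bookkeeping over ★ tables; nothing printed is asserted; no census law is stated; the band letters, (OFF), (ROW), (β₂) stay HYPOTHESES (β₂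
UNPROVED); `HC_CM` is proved only modulo the 7 printed citations (2 remaining named inputs: hLiu418 = `stmt-HodgeConjecture-24832`, h413 = `stmt-HodgeConjecture-24833`) until
rung 0 closes.
## References
* [Jacobowitz1962] R. Jacobowitz, *Hermitian forms over local fields*, Amer. J. Math. 84 (1962): §4 (duals, modular components, gluing).
* [BruhatTits1972] F. Bruhat, J. Tits, *Groupes réductifs sur un corps local I*, Publ. Math. IHÉS 41 (1972): §10.
* [Kottwitz1986BaseChangeUnits] R. E. Kottwitz, *Base change for unit elements of Hecke algebras*, Compositio Math. 60 (1986): §1 pp. 240–241.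
-/

set_option autoImplicit false

noncomputable section

open scoped Pointwise Valued WithZero Matrix MatrixGroups
open WithZero
open scoped Classical
open Literature.NumberTheory.Automorphic Literature.NumberTheory.Automorphic.HermitianLattice Literature.NumberTheory.Automorphic.UnitaryLatticeTree
open Literature.NumberTheory.Automorphic.EllipticPlaneAsFieldLine
open Literature.NumberTheory.LocalFields.QuadraticOrder
open Summit.HodgeConjecture.HodgeConjecture.Cruxes.H413.F0P3cDyRamToricCensusDefs
open Summit.HodgeConjecture.HodgeConjecture.Cruxes.H413.F0P3cDyRamConeLevelTransport

namespace Summit.HodgeConjecture.HodgeConjecture.Cruxes.H413.F0P3cDyRamConeCellGluedVertexExistsOfWeight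

variable {E : Type} {M : Type*} [Field E] [Valued E ℤᵐ⁰] [Field M] [Valued M ℤᵐ⁰] {ρ Θ : M →+* M} {α : M}

/-- **RIDER — «THE GLUE FIBRE OVER THE CANONICAL PLANE DATUM IS COUNTED BY THE WEIGHT».**  Frame of ★ `…ConeCellFaceTube.exists_fixed_unit_weight_eq_natCard_normFibre` (block
`(H₂, h_W)`, `H₂` hermitian of UNIT determinant, `|h_W| = 1`, `σh_W = h_W`; ★ (C1)'s line model and weight letter `hf` VERBATIM; cell `(j, b)`, `1 ≤ b`, `lam ∈ 𝒪_j`).  THEN every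
`Λ ∈ levelSetDep(j, b; lam − jE u)` has plane data `B` with `φ(B) = Λ` over which the self-dual `L₃` with `L₃ ∩ W = ι_W B` and tube coordinate `b` number EXACTLY `f b j Λ`
(★ `exists_coneData_of_gen` + ★ Lit `ncard_glueFibre_map_planeMatrix_eq_natCard_normFibre` + ★ `map_glueNorm_eq` + `hf`). [cite: Jacobowitz1962, §4] [cite: BruhatTits1972, §10]
[cite: Kottwitz1986BaseChangeUnits, §1 pp. 240–241] -/
theorem exists_ncard_glued_eq_weight [IsDiscreteValuationRing 𝒪[E]]
    (σ : E →+* E) (hσ : ∀ a, σ (σ a) = a) (hvσ : ∀ a, Valued.v (σ a) = Valued.v a)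
    {ϖ : E} (hϖ : Valued.v ϖ = WithZero.exp (-1 : ℤ))
    {H₂ : Matrix (Fin 2) (Fin 2) E} (hH₂ : IsUnit H₂.det) (hH₂σ : (H₂.map σ)ᵀ = H₂) {hW : E} (hhW : Valued.v hW = 1) (hhWσ : σ hW = hW) (jE : E →+* M)
    (hρρ : ∀ x, ρ (ρ x) = x) (hvρ : ∀ x, Valued.v (ρ x) = Valued.v x) (hα : ρ α ≠ α) (hα1 : Valued.v α ≤ 1)
    (hint : ∀ z : M, Valued.v z ≤ 1 → Valued.v ((z - ρ z) / (α - ρ α)) ≤ 1)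
    (hΘΘ : ∀ x, Θ (Θ x) = x) (hΘρ : ∀ x, Θ (ρ x) = ρ (Θ x)) (hvΘ : ∀ x, Valued.v (Θ x) = Valued.v x) (hΘj : ∀ x, Θ (jE x) = jE (σ x))
    (hjv : ∀ c, Valued.v (jE c) ≤ 1 ↔ Valued.v c ≤ 1) (hjfix : ∀ z, ρ z = z ↔ ∃ c, jE c = z)
    (hjpow : ∀ (t : E) (n : ℤ), Valued.v (jE t) = Valued.v (jE ϖ) ^ n ↔ Valued.v t = Valued.v ϖ ^ n)
    (hϖmax : ∀ t : M, ρ t = t → Valued.v t < 1 → Valued.v t ≤ Valued.v (jE ϖ))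
    (φ : (Fin 2 → E) →+ M) (hφs : ∀ (c : E) (x : Fin 2 → E), φ (c • x) = jE c * φ x) (hφi : Function.Injective φ) (hφo : Function.Surjective φ)
    {γ₂ : GL (Fin 2) E} {lam h : M} (hφγ : ∀ x, φ ((γ₂ : Matrix (Fin 2) (Fin 2) E).mulVec x) = lam * φ x) (hlam : Valued.v lam = 1)
    (hΘh : Θ h = h) (hh : h ≠ 0) (hform : ∀ x y, jE (pairing σ H₂ x y) = h * Θ (φ x) * φ y + ρ (h * Θ (φ x) * φ y))
    (u : E) {b : ℕ} (hb : 1 ≤ b) {j : ℕ} (hlamj : IsOrd ρ α (jE ϖ ^ j) lam)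
    (f : ℕ → ℕ → AddSubgroup M → ℕ)
    (hf : ∀ (b j : ℕ) (Λ : AddSubgroup M) (x₀ : M) (r : E), 1 ≤ b → x₀ ≠ 0 →
      (∀ x, x ∈ Λ ↔ ∃ z, IsOrd ρ α (jE ϖ ^ j) z ∧ x = x₀ * z) →
      IsOrd ρ α (jE ϖ ^ j) (dualGen ρ Θ α (jE ϖ ^ j) h x₀) → ¬ IsOrd ρ α (jE ϖ ^ j) (dualGen ρ Θ α (jE ϖ ^ j) h x₀ / jE ϖ) →
      Valued.v (dualGen ρ Θ α (jE ϖ ^ j) h x₀) = Valued.v (jE ϖ) ^ b →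
      (∀ b', (∀ x ∈ Λ, Valued.v (h * Θ x * b' + ρ (h * Θ x * b')) ≤ 1) → (lam - jE u) * b' ∈ Λ) →
      IsOrd ρ α (jE ϖ ^ j) lam → jE r = glueUnit ρ Θ α (jE ϖ ^ j) h (jE ϖ) (jE hW) x₀ b →
      f b j Λ = Nat.card {x : 𝒪[E] ⧸ 𝓂[E] ^ (2 * b) // ∃ u' : 𝒪[E], Ideal.Quotient.mk (𝓂[E] ^ (2 * b)) u' = x ∧
        Valued.v ((u' : E) * σ u' - r) ≤ Valued.v (ϖ ^ (2 * b))})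
    {Λ : AddSubgroup M} (hΛ : Λ ∈ levelSetDep ρ Θ α (jE ϖ) h j b (lam - jE u)) :
    ∃ B : Submodule 𝒪[E] (Fin 2 → E), B.toAddSubgroup.map φ = Λ ∧
      {L₃ : Submodule 𝒪[E] (Fin 3 → E) | IsSelfDualLattice σ ϖ (!![H₂ 0 0, 0, H₂ 0 1; 0, hW, 0; H₂ 1 0, 0, H₂ 1 1] : Matrix (Fin 3) (Fin 3) E) L₃ ∧
        L₃ ⊓ LinearMap.ker ((LinearMap.proj (1 : Fin 3) : (Fin 3 → E) →ₗ[E] E).restrictScalars 𝒪[E]) =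
          B.map ((Matrix.toLin' (!![1, 0; 0, 0; 0, 1] : Matrix (Fin 3) (Fin 2) E)).restrictScalars 𝒪[E]) ∧
        ∀ c : E, (Pi.single 1 c : Fin 3 → E) ∈ L₃ ↔ Valued.v c ≤ Valued.v ϖ ^ b}.ncard = f b j Λ := by
  have hvϖ0 : Valued.v ϖ ≠ 0 := by rw [hϖ]; exact WithZero.exp_ne_zero
  have hϖ0 : ϖ ≠ 0 := fun h0 => by rw [h0, map_zero] at hvϖ0; exact hvϖ0 rfl
  have hϖ1 : Valued.v ϖ < 1 := by rw [hϖ, ← WithZero.exp_zero, WithZero.exp_lt_exp]; norm_num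
  obtain ⟨⟨x₀, hx₀, hΛx, hyO, hyprim, hylev⟩, hdepΛ⟩ := hΛ
  -- the canonical cone data of the member: a full plane lattice `B = g·𝒪²` with `φ(B) = Λ`, and `w₀` with `φ w₀ = Y⁻¹x₀` and the two plane tokens
  obtain ⟨B, hBΛ, ⟨g, hBg⟩, -, w₀, hw₀Y, hG1, -, hw₀, -⟩ := exists_coneData_of_gen σ hϖ0 hϖ1 H₂ jE hρρ hvρ hα hα1 hint hΘΘ hΘρ hvΘ hjv hjfix hjpow hϖmax
    φ hφs hφi hφo hφγ hlam hΘh hh hform u hb hx₀ hΛx hyO hyprim hylev hdepΛ hlamj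
  have hG1' : dualLatt σ H₂ (B ⊔ Submodule.span 𝒪[E] {w₀}) = B := (dualLatt_sup_span_eq_iff_forall_mem_iff hvσ H₂ B w₀).2 hG1
  -- the glue fibre over `(B, b)` is counted by `#Sol_{2b}(r₀)`, `jE r₀ = glueUnit(x₀, b)`, and `hf` reads the same count as the weight
  have hcount := ncard_glueFibre_map_planeMatrix_eq_natCard_normFibre σ hσ hvσ hϖ hH₂ hH₂σ hhW hhWσ g hBg hb hG1' hw₀
  have hr₀ : jE (-(pairing σ H₂ w₀ w₀) * (ϖ ^ b * σ (ϖ ^ b)) / hW) = glueUnit ρ Θ α (jE ϖ ^ j) h (jE ϖ) (jE hW) x₀ b :=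
    map_glueNorm_eq σ H₂ jE hΘj φ hform hw₀Y ϖ hW b
  refine ⟨B, hBΛ, ?_⟩
  rw [hcount, hf b j Λ x₀ _ hb hx₀ hΛx hyO hyprim hylev hdepΛ hlamj hr₀]

/-- **HEAD — «A POPULATED CONE-CELL MEMBER CARRIES A GLUED SELF-DUAL VERTEX» (conductor-free, parity-free).**  Same frame; cell `(j, b)` with `1 ≤ b`, `lam ∈ 𝒪_j`.  THEN every
`Λ ∈ levelSetDep(j, b; lam − jE u)` with glue weight `f b j Λ ≠ 0` has plane data `B` with `φ(B) = Λ` and a glued vertex: a self-dual `L₃` for the block form with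
`L₃ ∩ W = ι_W B` and tube coordinate `b` (RIDER + `Set.nonempty_of_ncard_ne_zero`).  At `b + 1 ≤ d` the guard is automatic (★ `weight_eq_pow_of_mem_levelSetDep_of_succ_le`:
`f = q^b`) and this is ★ p863858; at `d ≤ b` the guard is exactly «the glue unit is a norm» (★ `weight_eq_two_mul_pow_or_eq_zero_of_le`). [cite: Jacobowitz1962, §4]
[cite: BruhatTits1972, §10] [cite: Kottwitz1986BaseChangeUnits, §1 pp. 240–241] -/
theorem exists_glued_of_mem_levelSetDep_of_weight_ne_zero [IsDiscreteValuationRing 𝒪[E]]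
    (σ : E →+* E) (hσ : ∀ a, σ (σ a) = a) (hvσ : ∀ a, Valued.v (σ a) = Valued.v a)
    {ϖ : E} (hϖ : Valued.v ϖ = WithZero.exp (-1 : ℤ))
    {H₂ : Matrix (Fin 2) (Fin 2) E} (hH₂ : IsUnit H₂.det) (hH₂σ : (H₂.map σ)ᵀ = H₂) {hW : E} (hhW : Valued.v hW = 1) (hhWσ : σ hW = hW) (jE : E →+* M)
    (hρρ : ∀ x, ρ (ρ x) = x) (hvρ : ∀ x, Valued.v (ρ x) = Valued.v x) (hα : ρ α ≠ α) (hα1 : Valued.v α ≤ 1)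
    (hint : ∀ z : M, Valued.v z ≤ 1 → Valued.v ((z - ρ z) / (α - ρ α)) ≤ 1)
    (hΘΘ : ∀ x, Θ (Θ x) = x) (hΘρ : ∀ x, Θ (ρ x) = ρ (Θ x)) (hvΘ : ∀ x, Valued.v (Θ x) = Valued.v x) (hΘj : ∀ x, Θ (jE x) = jE (σ x))
    (hjv : ∀ c, Valued.v (jE c) ≤ 1 ↔ Valued.v c ≤ 1) (hjfix : ∀ z, ρ z = z ↔ ∃ c, jE c = z)
    (hjpow : ∀ (t : E) (n : ℤ), Valued.v (jE t) = Valued.v (jE ϖ) ^ n ↔ Valued.v t = Valued.v ϖ ^ n)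
    (hϖmax : ∀ t : M, ρ t = t → Valued.v t < 1 → Valued.v t ≤ Valued.v (jE ϖ))
    (φ : (Fin 2 → E) →+ M) (hφs : ∀ (c : E) (x : Fin 2 → E), φ (c • x) = jE c * φ x) (hφi : Function.Injective φ) (hφo : Function.Surjective φ)
    {γ₂ : GL (Fin 2) E} {lam h : M} (hφγ : ∀ x, φ ((γ₂ : Matrix (Fin 2) (Fin 2) E).mulVec x) = lam * φ x) (hlam : Valued.v lam = 1)
    (hΘh : Θ h = h) (hh : h ≠ 0) (hform : ∀ x y, jE (pairing σ H₂ x y) = h * Θ (φ x) * φ y + ρ (h * Θ (φ x) * φ y))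
    (u : E) {b : ℕ} (hb : 1 ≤ b) {j : ℕ} (hlamj : IsOrd ρ α (jE ϖ ^ j) lam)
    (f : ℕ → ℕ → AddSubgroup M → ℕ)
    (hf : ∀ (b j : ℕ) (Λ : AddSubgroup M) (x₀ : M) (r : E), 1 ≤ b → x₀ ≠ 0 →
      (∀ x, x ∈ Λ ↔ ∃ z, IsOrd ρ α (jE ϖ ^ j) z ∧ x = x₀ * z) →
      IsOrd ρ α (jE ϖ ^ j) (dualGen ρ Θ α (jE ϖ ^ j) h x₀) → ¬ IsOrd ρ α (jE ϖ ^ j) (dualGen ρ Θ α (jE ϖ ^ j) h x₀ / jE ϖ) →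
      Valued.v (dualGen ρ Θ α (jE ϖ ^ j) h x₀) = Valued.v (jE ϖ) ^ b →
      (∀ b', (∀ x ∈ Λ, Valued.v (h * Θ x * b' + ρ (h * Θ x * b')) ≤ 1) → (lam - jE u) * b' ∈ Λ) →
      IsOrd ρ α (jE ϖ ^ j) lam → jE r = glueUnit ρ Θ α (jE ϖ ^ j) h (jE ϖ) (jE hW) x₀ b →
      f b j Λ = Nat.card {x : 𝒪[E] ⧸ 𝓂[E] ^ (2 * b) // ∃ u' : 𝒪[E], Ideal.Quotient.mk (𝓂[E] ^ (2 * b)) u' = x ∧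
        Valued.v ((u' : E) * σ u' - r) ≤ Valued.v (ϖ ^ (2 * b))})
    {Λ : AddSubgroup M} (hΛ : Λ ∈ levelSetDep ρ Θ α (jE ϖ) h j b (lam - jE u)) (hfne : f b j Λ ≠ 0) :
    ∃ B : Submodule 𝒪[E] (Fin 2 → E), B.toAddSubgroup.map φ = Λ ∧
      ∃ L₃ : Submodule 𝒪[E] (Fin 3 → E), IsSelfDualLattice σ ϖ (!![H₂ 0 0, 0, H₂ 0 1; 0, hW, 0; H₂ 1 0, 0, H₂ 1 1] : Matrix (Fin 3) (Fin 3) E) L₃ ∧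
        L₃ ⊓ LinearMap.ker ((LinearMap.proj (1 : Fin 3) : (Fin 3 → E) →ₗ[E] E).restrictScalars 𝒪[E]) =
          B.map ((Matrix.toLin' (!![1, 0; 0, 0; 0, 1] : Matrix (Fin 3) (Fin 2) E)).restrictScalars 𝒪[E]) ∧
        (∀ c : E, (Pi.single 1 c : Fin 3 → E) ∈ L₃ ↔ Valued.v c ≤ Valued.v ϖ ^ b) := by
  obtain ⟨B, hBΛ, hcount⟩ := exists_ncard_glued_eq_weight σ hσ hvσ hϖ hH₂ hH₂σ hhW hhWσ jE hρρ hvρ hα hα1 hint hΘΘ hΘρ hvΘ hΘj hjv hjfix hjpow hϖmax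
    φ hφs hφi hφo hφγ hlam hΘh hh hform u hb hlamj f hf hΛ
  have hne : {L₃ : Submodule 𝒪[E] (Fin 3 → E) | IsSelfDualLattice σ ϖ (!![H₂ 0 0, 0, H₂ 0 1; 0, hW, 0; H₂ 1 0, 0, H₂ 1 1] : Matrix (Fin 3) (Fin 3) E) L₃ ∧
        L₃ ⊓ LinearMap.ker ((LinearMap.proj (1 : Fin 3) : (Fin 3 → E) →ₗ[E] E).restrictScalars 𝒪[E]) =
          B.map ((Matrix.toLin' (!![1, 0; 0, 0; 0, 1] : Matrix (Fin 3) (Fin 2) E)).restrictScalars 𝒪[E]) ∧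
        ∀ c : E, (Pi.single 1 c : Fin 3 → E) ∈ L₃ ↔ Valued.v c ≤ Valued.v ϖ ^ b}.ncard ≠ 0 := by
    rw [hcount]; exact hfne
  obtain ⟨L₃, hL, hLB, htube⟩ := Set.nonempty_of_ncard_ne_zero hne
  exact ⟨B, hBΛ, L₃, hL, hLB, htube⟩

/-- **COROLLARY — «EMPTY FIBRE ⇒ WEIGHT ZERO», the contrapositive reading used by the count sockets**: if NO glued self-dual `L₃` with tube `b` sits over ANY plane datum `B` with
`φ(B) = Λ`, then `f b j Λ = 0` (so such members drop out of every weighted (OFF) sum). [cite: Jacobowitz1962, §4] [cite: Kottwitz1986BaseChangeUnits, §1 pp. 240–241] -/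
theorem weight_eq_zero_of_forall_not_glued [IsDiscreteValuationRing 𝒪[E]]
    (σ : E →+* E) (hσ : ∀ a, σ (σ a) = a) (hvσ : ∀ a, Valued.v (σ a) = Valued.v a)
    {ϖ : E} (hϖ : Valued.v ϖ = WithZero.exp (-1 : ℤ))
    {H₂ : Matrix (Fin 2) (Fin 2) E} (hH₂ : IsUnit H₂.det) (hH₂σ : (H₂.map σ)ᵀ = H₂) {hW : E} (hhW : Valued.v hW = 1) (hhWσ : σ hW = hW) (jE : E →+* M)
    (hρρ : ∀ x, ρ (ρ x) = x) (hvρ : ∀ x, Valued.v (ρ x) = Valued.v x) (hα : ρ α ≠ α) (hα1 : Valued.v α ≤ 1)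
    (hint : ∀ z : M, Valued.v z ≤ 1 → Valued.v ((z - ρ z) / (α - ρ α)) ≤ 1)
    (hΘΘ : ∀ x, Θ (Θ x) = x) (hΘρ : ∀ x, Θ (ρ x) = ρ (Θ x)) (hvΘ : ∀ x, Valued.v (Θ x) = Valued.v x) (hΘj : ∀ x, Θ (jE x) = jE (σ x))
    (hjv : ∀ c, Valued.v (jE c) ≤ 1 ↔ Valued.v c ≤ 1) (hjfix : ∀ z, ρ z = z ↔ ∃ c, jE c = z)
    (hjpow : ∀ (t : E) (n : ℤ), Valued.v (jE t) = Valued.v (jE ϖ) ^ n ↔ Valued.v t = Valued.v ϖ ^ n)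
    (hϖmax : ∀ t : M, ρ t = t → Valued.v t < 1 → Valued.v t ≤ Valued.v (jE ϖ))
    (φ : (Fin 2 → E) →+ M) (hφs : ∀ (c : E) (x : Fin 2 → E), φ (c • x) = jE c * φ x) (hφi : Function.Injective φ) (hφo : Function.Surjective φ)
    {γ₂ : GL (Fin 2) E} {lam h : M} (hφγ : ∀ x, φ ((γ₂ : Matrix (Fin 2) (Fin 2) E).mulVec x) = lam * φ x) (hlam : Valued.v lam = 1)
    (hΘh : Θ h = h) (hh : h ≠ 0) (hform : ∀ x y, jE (pairing σ H₂ x y) = h * Θ (φ x) * φ y + ρ (h * Θ (φ x) * φ y))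
    (u : E) {b : ℕ} (hb : 1 ≤ b) {j : ℕ} (hlamj : IsOrd ρ α (jE ϖ ^ j) lam)
    (f : ℕ → ℕ → AddSubgroup M → ℕ)
    (hf : ∀ (b j : ℕ) (Λ : AddSubgroup M) (x₀ : M) (r : E), 1 ≤ b → x₀ ≠ 0 →
      (∀ x, x ∈ Λ ↔ ∃ z, IsOrd ρ α (jE ϖ ^ j) z ∧ x = x₀ * z) →
      IsOrd ρ α (jE ϖ ^ j) (dualGen ρ Θ α (jE ϖ ^ j) h x₀) → ¬ IsOrd ρ α (jE ϖ ^ j) (dualGen ρ Θ α (jE ϖ ^ j) h x₀ / jE ϖ) →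
      Valued.v (dualGen ρ Θ α (jE ϖ ^ j) h x₀) = Valued.v (jE ϖ) ^ b →
      (∀ b', (∀ x ∈ Λ, Valued.v (h * Θ x * b' + ρ (h * Θ x * b')) ≤ 1) → (lam - jE u) * b' ∈ Λ) →
      IsOrd ρ α (jE ϖ ^ j) lam → jE r = glueUnit ρ Θ α (jE ϖ ^ j) h (jE ϖ) (jE hW) x₀ b →
      f b j Λ = Nat.card {x : 𝒪[E] ⧸ 𝓂[E] ^ (2 * b) // ∃ u' : 𝒪[E], Ideal.Quotient.mk (𝓂[E] ^ (2 * b)) u' = x ∧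
        Valued.v ((u' : E) * σ u' - r) ≤ Valued.v (ϖ ^ (2 * b))})
    {Λ : AddSubgroup M} (hΛ : Λ ∈ levelSetDep ρ Θ α (jE ϖ) h j b (lam - jE u))
    (hno : ∀ B : Submodule 𝒪[E] (Fin 2 → E), B.toAddSubgroup.map φ = Λ →
      ∀ L₃ : Submodule 𝒪[E] (Fin 3 → E), IsSelfDualLattice σ ϖ (!![H₂ 0 0, 0, H₂ 0 1; 0, hW, 0; H₂ 1 0, 0, H₂ 1 1] : Matrix (Fin 3) (Fin 3) E) L₃ →
        L₃ ⊓ LinearMap.ker ((LinearMap.proj (1 : Fin 3) : (Fin 3 → E) →ₗ[E] E).restrictScalars 𝒪[E]) =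
          B.map ((Matrix.toLin' (!![1, 0; 0, 0; 0, 1] : Matrix (Fin 3) (Fin 2) E)).restrictScalars 𝒪[E]) →
        ¬ ∀ c : E, (Pi.single 1 c : Fin 3 → E) ∈ L₃ ↔ Valued.v c ≤ Valued.v ϖ ^ b) :
    f b j Λ = 0 := by
  by_contra hfne
  obtain ⟨B, hBΛ, L₃, hL, hLB, htube⟩ := exists_glued_of_mem_levelSetDep_of_weight_ne_zero σ hσ hvσ hϖ hH₂ hH₂σ hhW hhWσ jE hρρ hvρ hα hα1 hint hΘΘ hΘρ hvΘ
    hΘj hjv hjfix hjpow hϖmax φ hφs hφi hφo hφγ hlam hΘh hh hform u hb hlamj f hf hΛ hfne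
  exact hno B hBΛ L₃ hL hLB htube

end Summit.HodgeConjecture.HodgeConjecture.Cruxes.H413.F0P3cDyRamConeCellGluedVertexExistsOfWeight

end
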